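import Literature.NumberTheory.GaloisRepresentations.GaloisCohomologyKummerProofs
import HarnessLib

/-!
# Kummer theory at the COCYCLE level: every continuous `μₙ`-valued 1-cocycle of `Γ_K` IS a Kummer cocycle

J.-P. Serre, *Local Fields*, GTM 67 (1979), Ch. X §3 b) («Kummer theory»: for `n` invertible in `K`,
`1 → μₙ → K_sˣ → K_sˣ → 1` and Hilbert's Theorem 90 give `H¹(G(K_s/K), μₙ) = Kˣ/Kˣⁿ`)
[cite: Serre1979, Ch. X §3 b)]; J.-P. Serre, *Galois Cohomology* (1997), Ch. II §1.2, Prop. 1 and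
Corollary. PROOF-ONLY file (no definition, no named fact): a COCYCLE-LEVEL sharpening of the tree's
Kummer isomorphism `Literature.NumberTheory.GaloisRepresentations.kummerEquiv : H¹(K, μₙ) ≃+ Kˣ/(Kˣ)ⁿ`
(`GaloisCohomologyKummerProofs.lean`), obtained directly from the tree's cocycle-level Hilbert 90
`absoluteGaloisGroup.exists_eq_smul_div_of_isLocallyConstant_cocycle`.

For EVERY field `K` (no perfectness assumption), `n` invertible in `K`, `Γ_K = Field.absoluteGaloisGroup K`
acting on `K̄ = AlgebraicClosure K`:

* `absoluteGaloisGroup.exists_kummer_eq_of_isLocallyConstant_cocycle` — **every locally constant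
  (= continuous) `μₙ(K̄)`-valued multiplicative 1-cocycle `c : Γ_K → K̄ˣ` (`c (στ) = c σ · σ(c τ)`,
  `(c σ)ⁿ = 1`) is EXACTLY a Kummer cocycle**: `c σ = σ(α)/α` for an `n`-th root `α ∈ K̄ˣ` of some
  `a ∈ Kˣ` — no coboundary correction is needed at the cocycle level (Hilbert 90 gives `c σ = σβ/β`;
  `βⁿ` is `Γ_K`-fixed, so `β^{n q^m} ∈ K` with `q` the exponential characteristic; Bezout
  `u q^m + v n = 1` and `cⁿ = 1` give `c = (c^{q^m})ᵘ`, the Kummer cocycle of `α := β^{q^m u}`,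
  `αⁿ = (β^{n q^m})ᵘ ∈ Kˣ`; for perfect `K`, `m = 0`);
* `…_forall_root` — the same with an ARBITRARY `n`-th root `α'` of the same `a`: `c σ = (σα'/α')·(σζ/ζ)`
  for some `ζ ∈ μₙ(K̄)` (the two roots differ by `ζ`; with the Galois action on `μₙ` non-trivial this
  is the coboundary of `ζ`) — the shape in which a consumer with a FIXED root-choice function uses it;
* `exists_kummerOneCocycle_eq` — the same in the tree's bundled vocabulary: every
  `φ : contOneCocycles (mu K n).toTopRep` equals `kummerOneCocycle K n α` for a Kummer unit `α` with
  `αⁿ ∈ Kˣ`;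
* `absoluteGaloisGroup.exists_kummer_eq_of_isLocallyConstant_hom` — when `μₙ(K̄) ⊆ K` (trivial
  action) a cocycle is a HOMOMORPHISM: every locally constant homomorphism `χ : Γ_K → μₙ` is
  `σ ↦ σ(α)/α`, `αⁿ ∈ Kˣ`.

Consumer (cell abc-iut, layer L2, GAP-LEDGER row G-L2t11-2 (a) «continuous Kummer adapter», L2-lead
RULINGS/ROWS #1 (gen 3) R1 → seat abc-iut-w5-d234; R2 = the instantiation at the [EtTh] §5 Kummer
vocabulary by abc-iut-w4-d095): the binder `hKumC` of
`Literature.AnabelianGeometry.EtaleTheta.ThetaFrobenioid.BiratAutAction.kummerOutReached_birat_of_continuous`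
(abc-iut-L6-t23, `Discharge/Sec5KummerOutReachedContinuous.lean`) asks, for every CONTINUOUS `μ_N`-valued
cocycle `δ₀` of `G_K`, for an `N`-th root `f` of a constant and `a ∈ μ_N` with
`δ₀ = (Kummer cocycle of f)⁻¹ · (coboundary of a)` — supplied by `…_forall_root` with `f := ` the fixed
root of `a⁻¹` (or `a`, inverting) once `(T.G, T.mu, KxRootN)` are identified with `(Γ_K, μ_N(K̄), ⁿ√Kˣ)`.
Nothing of [EtTh] is used or asserted here; classical and undisputed.
-/

noncomputable section

namespace Literature.NumberTheory.GaloisRepresentations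

open Field Topology DiscreteGaloisModule

universe u

variable (K : Type u) [Field K] (n : ℕ) [NeZero (n : K)]

/-- **Kummer theory at the cocycle level.** For `n` invertible in `K`, every locally constant
`μₙ(K̄)`-valued multiplicative `1`-cocycle `c : Γ_K → K̄ˣ` — `c (στ) = c σ · σ(c τ)`, `(c σ)ⁿ = 1` — is
EXACTLY the Kummer cocycle `σ ↦ σ(α)/α` of an `n`-th root `α ∈ K̄ˣ` of an element `a ∈ Kˣ`. (Hilbert 90:
`c σ = σβ/β`; `βⁿ` is `Γ_K`-fixed, hence `β^{n q^m} ∈ K` for the exponential characteristic `q`; with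
`u q^m + v n = 1` and `cⁿ = 1`, `c = (c^{q^m})ᵘ` is the Kummer cocycle of `α := (β^{q^m})ᵘ`.)
[cite: Serre1979, Ch. X §3 b)] -/
theorem absoluteGaloisGroup.exists_kummer_eq_of_isLocallyConstant_cocycle
    {c : absoluteGaloisGroup K → (AlgebraicClosure K)ˣ} (hc : IsLocallyConstant c)
    (hn : ∀ σ, c σ ^ n = 1) (hcoc : ∀ σ τ, c (σ * τ) = c σ * σ • c τ) :
    ∃ (a : Kˣ) (α : (AlgebraicClosure K)ˣ),
      α ^ n = Units.map (algebraMap K (AlgebraicClosure K) : K →* AlgebraicClosure K) a ∧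
      ∀ σ, c σ = σ • α / α := by
  obtain ⟨q, hq⟩ := ExpChar.exists K
  -- Hilbert 90 for the `K̄`-valued cocycle `σ ↦ ↑(c σ)`
  have hc' : IsLocallyConstant fun σ => ((c σ : (AlgebraicClosure K)ˣ) : AlgebraicClosure K) :=
    hc.comp _
  have h0 : ∀ σ, ((c σ : (AlgebraicClosure K)ˣ) : AlgebraicClosure K) ≠ 0 := fun σ => (c σ).ne_zero
  have hcoc' : ∀ σ τ, ((c (σ * τ) : (AlgebraicClosure K)ˣ) : AlgebraicClosure K) =
      (c σ : AlgebraicClosure K) * σ • (c τ : AlgebraicClosure K) := by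
    intro σ τ
    rw [hcoc, Units.val_mul, Units.coe_smul]
  obtain ⟨β, hβ0, hβ⟩ :=
    absoluteGaloisGroup.exists_eq_smul_div_of_isLocallyConstant_cocycle K hc' h0 hcoc'
  -- as units: `c σ = σ • γ / γ`, `γ := β`
  set γ : (AlgebraicClosure K)ˣ := Units.mk0 β hβ0 with hγ
  have hcγ : ∀ σ, c σ = σ • γ / γ := by
    intro σ
    ext
    rw [hβ σ, Units.val_div_eq_div_val, Units.coe_smul, hγ, Units.val_mk0]
  -- `γⁿ` is `Γ_K`-fixed
  have hfix : ∀ σ : absoluteGaloisGroup K, σ • γ ^ n = γ ^ n := by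
    intro σ
    have h := hn σ
    rwa [hcγ σ, div_pow, ← smul_pow', div_eq_one] at h
  have hfix' : ∀ σ : absoluteGaloisGroup K,
      σ • ((γ ^ n : (AlgebraicClosure K)ˣ) : AlgebraicClosure K) = (γ ^ n : (AlgebraicClosure K)ˣ) := by
    intro σ
    rw [← Units.coe_smul, hfix σ]
  -- `(γⁿ)^(q^m) = a₀ ∈ K`
  obtain ⟨m, a₀, ha₀⟩ := absoluteGaloisGroup.exists_algebraMap_eq_pow_of_forall_smul_eq K q hfix'
  have ha₀0 : a₀ ≠ 0 := by
    intro h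
    apply pow_ne_zero (q ^ m) (γ ^ n).ne_zero
    rw [← ha₀, h, map_zero]
  set a₁ : Kˣ := Units.mk0 a₀ ha₀0 with ha₁
  have ha₁' : Units.map (algebraMap K (AlgebraicClosure K) : K →* AlgebraicClosure K) a₁ =
      (γ ^ q ^ m) ^ n := by
    ext
    rw [Units.coe_map, MonoidHom.coe_coe, ha₁, Units.val_mk0, ha₀]
    push_cast
    ring
  -- Bezout: `u * q^m + v * n = 1`
  obtain ⟨u, v, huv⟩ := Nat.isCoprime_iff_coprime.2 (coprime_expChar_pow_of_neZero K q n m)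
  -- exchanging an integer and a natural exponent
  have hpow : ∀ x : (AlgebraicClosure K)ˣ, (x ^ u) ^ n = (x ^ n) ^ u := fun x => by
    rw [← zpow_natCast, ← zpow_mul, ← zpow_natCast x n, ← zpow_mul, mul_comm]
  refine ⟨a₁ ^ u, (γ ^ q ^ m) ^ u, ?_, fun σ => ?_⟩
  · -- `((γ^(q^m))^u)^n = (a₁)^u`
    rw [map_zpow, ha₁', hpow]
  · -- `σ • α / α = ((c σ)^(q^m))^u = c σ`
    have hk : σ • ((γ ^ q ^ m) ^ u) / (γ ^ q ^ m) ^ u = ((c σ) ^ ((q ^ m : ℕ) : ℤ)) ^ u := by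
      rw [smul_zpow', ← div_zpow, smul_pow', ← div_pow, ← hcγ σ, zpow_natCast]
    rw [hk]
    calc c σ = c σ ^ (1 : ℤ) := (zpow_one _).symm
      _ = c σ ^ (u * ((q ^ m : ℕ) : ℤ) + v * (n : ℤ)) := by rw [huv]
      _ = (c σ ^ ((q ^ m : ℕ) : ℤ)) ^ u * (c σ ^ (n : ℤ)) ^ v := by
          rw [zpow_add, mul_comm u, zpow_mul, mul_comm v, zpow_mul]
      _ = (c σ ^ ((q ^ m : ℕ) : ℤ)) ^ u := by rw [zpow_natCast (c σ) n, hn σ, one_zpow, mul_one]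

/-- **Cocycle-level Kummer theory relative to an ARBITRARY root.** With `a ∈ Kˣ` as in
`exists_kummer_eq_of_isLocallyConstant_cocycle`, for EVERY `n`-th root `α'` of `a` there is `ζ ∈ μₙ(K̄)`
with `c σ = (σ(α')/α') · (σ(ζ)/ζ)` — the Kummer cocycle of the chosen root times the coboundary of `ζ`
(two `n`-th roots of `a` differ by an `n`-th root of unity). This is the shape a consumer working with a
fixed root-choice function needs. [cite: Serre1979, Ch. X §3 b)] -/
theorem absoluteGaloisGroup.exists_kummer_eq_of_isLocallyConstant_cocycle_forall_root
    {c : absoluteGaloisGroup K → (AlgebraicClosure K)ˣ} (hc : IsLocallyConstant c)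
    (hn : ∀ σ, c σ ^ n = 1) (hcoc : ∀ σ τ, c (σ * τ) = c σ * σ • c τ) :
    ∃ a : Kˣ, ∀ α' : (AlgebraicClosure K)ˣ,
      α' ^ n = Units.map (algebraMap K (AlgebraicClosure K) : K →* AlgebraicClosure K) a →
      ∃ ζ : (AlgebraicClosure K)ˣ, ζ ^ n = 1 ∧ ∀ σ, c σ = (σ • α' / α') * (σ • ζ / ζ) := by
  obtain ⟨a, α, hα, hcα⟩ := absoluteGaloisGroup.exists_kummer_eq_of_isLocallyConstant_cocycle K n hc hn hcoc
  refine ⟨a, fun α' hα' => ⟨α / α', ?_, fun σ => ?_⟩⟩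
  · rw [div_pow, hα, hα', div_self']
  · rw [hcα σ, smul_div', div_mul_div_comm, mul_div_cancel, mul_comm, div_mul_eq_mul_div,
      mul_div_assoc, div_self', mul_one]

/-- **Every continuous `1`-cocycle of `Γ_K` in the Galois module `μₙ` IS a Kummer cocycle** — the
bundled form over the tree's `contOneCocycles (mu K n).toTopRep` / `kummerOneCocycle`: for every `φ` there
is a Kummer unit `α` (`αⁿ ∈ Kˣ`) with `kummerOneCocycle K n α = φ` (equality of cocycles, not only of
classes — compare `kummerMap_surjective`). [cite: Serre1979, Ch. X §3 b)] -/
theorem exists_kummerOneCocycle_eq (φ : contOneCocycles (mu K n).toTopRep) :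
    ∃ (a : Kˣ) (α : kummerUnits K n),
      (α : (AlgebraicClosure K)ˣ) ^ n =
        Units.map (algebraMap K (AlgebraicClosure K) : K →* AlgebraicClosure K) a ∧
      kummerOneCocycle K n α = φ := by
  -- the units-valued cocycle `σ ↦ muVal (φ σ)`
  have hc : IsLocallyConstant fun σ => muVal K n (φ.1 σ) :=
    ((IsLocallyConstant.iff_continuous φ.1).2 φ.1.continuous).comp (muVal K n)
  have hn : ∀ σ, muVal K n (φ.1 σ) ^ n = 1 := fun σ => muVal_pow_eq_one K n _
  have hcoc : ∀ σ τ, muVal K n (φ.1 (σ * τ)) = muVal K n (φ.1 σ) * σ • muVal K n (φ.1 τ) := by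
    intro σ τ
    have h := congrArg (muVal K n) (φ.2 σ τ)
    simpa using h
  obtain ⟨a, α, hα, hcα⟩ :=
    absoluteGaloisGroup.exists_kummer_eq_of_isLocallyConstant_cocycle K n hc hn hcoc
  have hαmem : α ∈ kummerUnits K n := by
    intro σ
    rw [hα]
    ext
    rw [Units.coe_smul, Units.coe_map, MonoidHom.coe_coe, smul_algebraMap]
  refine ⟨a, ⟨α, hαmem⟩, hα, ?_⟩
  apply Subtype.ext
  ext σ
  apply muVal_injective K n
  rw [kummerOneCocycle_apply, muVal_kummerOneCocycleFun]
  exact (hcα σ).symm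

/-- **The trivial-action case (`μₙ(K̄) ⊆ K`)**: when `Γ_K` fixes the `n`-th roots of unity, a locally
constant homomorphism `χ : Γ_K → K̄ˣ` of exponent `n` (a continuous character with values in `μₙ`) is a
`1`-cocycle, hence `χ σ = σ(α)/α` for an `n`-th root `α` of some `a ∈ Kˣ` — print's «`Kˣ ↠ Kˣ/(Kˣ)^N ⥲
H¹(G_K, μ_N) = Hom(G_K, μ_N)`» at the level of homomorphisms. [cite: Serre1979, Ch. X §3 b)] -/
theorem absoluteGaloisGroup.exists_kummer_eq_of_isLocallyConstant_hom
    (hμ : ∀ (σ : absoluteGaloisGroup K) (ζ : (AlgebraicClosure K)ˣ), ζ ^ n = 1 → σ • ζ = ζ)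
    (χ : absoluteGaloisGroup K →* (AlgebraicClosure K)ˣ) (hχ : IsLocallyConstant χ)
    (hn : ∀ σ, χ σ ^ n = 1) :
    ∃ (a : Kˣ) (α : (AlgebraicClosure K)ˣ),
      α ^ n = Units.map (algebraMap K (AlgebraicClosure K) : K →* AlgebraicClosure K) a ∧
      ∀ σ, χ σ = σ • α / α :=
  absoluteGaloisGroup.exists_kummer_eq_of_isLocallyConstant_cocycle K n hχ hn fun σ τ => by
    rw [map_mul, hμ σ (χ τ) (hn τ)]

end Literature.NumberTheory.GaloisRepresentations

end
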